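import Mathlib
import HarnessLib
import Summits.NavierStokesRegularity.NavierStokesRegularity.Theorems.LocalVelCompTubeDoorLocalPointZoomVelSlices

/-!
# Door S11 `LocalTubeDoorHelicity` (nsreg-p1 ROUND-11, the FROBENIUS / helicity-density window door), zoom crux K1‴
# `LocalPointZoomVelCurlSlices` — local point zoom with pointwise VELOCITY AND VORTICITY convergence on every slice,
# along ONE common subsequence

Cell ns-regularity-ideate, seat p6 (route-directed support for the door family LocalSineTubeDoor → PoloidalWindowDoor →
LocalVelCompTubeDoor (S10) → S11; anchor `--supports stmt-NavierStokesRegularity-20017`, the zoom item of route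
LocalSineTubeDoor whose frame is re-used; edge re-pointed at birth).  The statement of `localPointZoomVelCurlSlices` is the
text of K1‴ in nsreg-p1's `r11/Sketch11.lean` with the profile class `IsTypeIProfile C v` spelled out as its four clauses
(Type-I rate, continuity on the open slab, unit-viscosity Oseen–Duhamel identity, divergence-free slices) — exactly the
clause list of the tree theorems `localPointZoomSlices` (vorticities) and `localPointZoomVelSlices` (velocities), of which
this is the CONJUNCTION ALONG ONE SUBSEQUENCE: both tree theorems read their convergence off the same local zoom frame
`localTreeZoomFrame` (same scales `R λⱼ / 2`, same profile `v₁`), so no second subsequence extraction is needed — for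
`σ = √(−s)` the frame rescales to `(v', π', σλⱼ, σ•w∘Φ_σ, σ•v₁∘Φ_σ)` (`zoom_zoom`, `eLpNorm_uncurry_zoom`,
`ae_eq_restrict_comp_stAffine`, `rate_smul_stPull` / `cont_smul_stPull` / `mild_smul_stPull`) and BOTH interior upgrades at
time `−1` of the rescaled frame — `localZoomFrame_tendsto` (velocity) and `localZoomFrame_curl_tendsto` (vorticity) — are
the two convergences at time `s` of the original one.

WHAT THIS IS NOT: not a claim about Navier–Stokes regularity; a blow-up/compactness lemma (local Type I, not backward
bounded ⇒ a Type-I Oseen-mild tangent flow with singular apex attracting the rescaled velocities AND vorticities pointwise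
on every slice) for a door route that is not yet staged (bears_on LADDER-NS N0).
-/

noncomputable section

-- the summit and its single sub-problem share the name (CONVENTIONS §1), as in every Theorems file
set_option linter.dupNamespace false

namespace Summit.NavierStokesRegularity.NavierStokesRegularity.Theorems.LocalHelicityTubeDoorLocalPointZoomVelCurlSlices

open MeasureTheory Set Function Filter Topology TopologicalSpace Metric
open Literature.Analysis Literature.Analysis.FluidPDE Literature.Analysis.FluidPDE.SereginSverak2009
open Summit.NavierStokesRegularity.NavierStokesRegularity.Theorems
open Summit.NavierStokesRegularity.NavierStokesRegularity.Theorems.LocalSineTubeDoorLocalPointZoomFrame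
open Summit.NavierStokesRegularity.NavierStokesRegularity.Theorems.LocalSineTubeDoorLocalPointZoomCurl
open Summit.NavierStokesRegularity.NavierStokesRegularity.Theorems.LocalSineTubeDoorLocalPointZoomSlices
open Summit.NavierStokesRegularity.NavierStokesRegularity.Theorems.LocalVelCompTubeDoorLocalPointZoomVel
open scoped NNReal ENNReal

/-- **LOCAL POINT ZOOM LIMIT WITH VELOCITY AND VORTICITY SLICES** (K1‴ of nsreg-p1 ROUND-11, door S11
`LocalTubeDoorHelicity`): at a point where a classical Leray–Hopf flow from rapidly decaying data is LOCALLY Type I but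
not backward bounded, some zoom sequence `λⱼ → 0⁺` of unit-viscosity rescalings converges to a Type-I-rate, continuous,
Oseen-mild, divergence-free profile `v` with backward-singular apex, and at EVERY `s < 0` and every `y` BOTH the rescaled
velocities `(λⱼ/ν) u(T + λⱼ²s/ν, x₀ + λⱼy) → v(s,y)` AND the rescaled vorticities
`(λⱼ²/ν) curl u(T + λⱼ²s/ν, ·)(x₀ + λⱼy) → curl (v s) y` — along ONE common sequence `λⱼ`. -/
theorem localPointZoomVelCurlSlices :
    ∀ (ν T : ℝ), 0 < ν → 0 < T → ∀ (u : ℝ → EuclideanSpace ℝ (Fin 3) → EuclideanSpace ℝ (Fin 3))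
      (p : ℝ → EuclideanSpace ℝ (Fin 3) → ℝ),
    Literature.Analysis.FluidPDE.IsClassicalNSSolutionOn (Set.Ico 0 T) ν 0 u p →
    Literature.Analysis.FluidPDE.IsLerayHopfOn T ν 0 (u 0) u →
    Literature.Analysis.FluidPDE.HasRapidSpatialDecay (u 0) →
    ∀ (x₀ : EuclideanSpace ℝ (Fin 3)) (ρ M : ℝ), 0 < ρ →
    (∀ t ∈ Set.Ico 0 T, T - ρ ^ 2 < t → ∀ x ∈ Metric.ball x₀ ρ, ‖u t x‖ * Real.sqrt (ν * (T - t)) ≤ M) →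
    ¬ Literature.Analysis.FluidPDE.IsBackwardBoundedAt u T x₀ →
    ∃ (C : ℝ) (v : ℝ → EuclideanSpace ℝ (Fin 3) → EuclideanSpace ℝ (Fin 3)) (lam : ℕ → ℝ),
      (∀ j, 0 < lam j) ∧ Filter.Tendsto lam Filter.atTop (nhds 0) ∧
      (Literature.Analysis.FluidPDE.HasTypeITimeDecay C v ∧
        ContinuousOn (Function.uncurry v) (Set.Iio (0 : ℝ) ×ˢ Set.univ) ∧
        (∀ s t : ℝ, s < t → t < 0 → ∀ x, v t x =
          Literature.Analysis.UnboundedOperators.heatExtension (v s) (t - s) x -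
            Literature.Analysis.FluidPDE.oseenDuhamel 1 s v v t x) ∧
        (∀ t < 0, Literature.Analysis.FluidPDE.VectorCalculus.IsDivFree (v t))) ∧
      Literature.Analysis.FluidPDE.IsBackwardSingularPoint v 0 ∧
      ∀ s < 0, ∀ y,
        Filter.Tendsto (fun j => (lam j / ν) • u (T + lam j ^ 2 * s / ν) (x₀ + lam j • y)) Filter.atTop
          (nhds (v s y)) ∧
        Filter.Tendsto (fun j => (lam j ^ 2 / ν) •
          Literature.Analysis.FluidPDE.curl (u (T + lam j ^ 2 * s / ν)) (x₀ + lam j • y)) Filter.atTop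
          (nhds (Literature.Analysis.FluidPDE.curl (v s) y)) := by
  intro ν T hν hT u p hsol hLH _ x₀ ρ M hρ hM hnotbd
  obtain ⟨R, C₁, v', π', lam, w, v₁, Ks, r₁, hR, hlam, hlam0, hball1, hr₁, hr₁1, hKs, hL3, hae, hP,
    hsing₁, hpt⟩ := localTreeZoomFrame hν hT hsol hLH hρ hM hnotbd
  refine ⟨C₁, v₁, fun j => R * (lam j / 2), fun j => mul_pos hR (half_pos (hlam j)),
    by simpa using (hlam0.div_const 2).const_mul R, hP, hsing₁, fun s hs y => ?_⟩
  -- ## the scaling factor `σ = √(−s)`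
  have hns : 0 < -s := neg_pos.2 hs
  set σ : ℝ := Real.sqrt (-s) with hσdef
  have hσ : 0 < σ := Real.sqrt_pos.2 hns
  have hσ2 : σ ^ 2 = -s := Real.sq_sqrt hns.le
  have hσne : σ ≠ 0 := hσ.ne'
  -- ## the rescaled frame
  set lam' : ℕ → ℝ := fun j => σ * lam j with hlam'def
  have hlam' : ∀ j, 0 < lam' j := fun j => mul_pos hσ (hlam j)
  have hlam0' : Tendsto lam' atTop (𝓝 0) := by
    show Tendsto (fun j => σ * lam j) atTop (𝓝 0)
    simpa using hlam0.const_mul σ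
  set w' : ℝ → (EuclideanSpace ℝ (Fin 3)) → (EuclideanSpace ℝ (Fin 3)) :=
    σ • stPull (σ ^ 2) σ (0 : ℝ) (0 : (EuclideanSpace ℝ (Fin 3))) w with hw'def
  set v₁' : ℝ → (EuclideanSpace ℝ (Fin 3)) → (EuclideanSpace ℝ (Fin 3)) :=
    σ • stPull (σ ^ 2) σ (0 : ℝ) (0 : (EuclideanSpace ℝ (Fin 3))) v₁ with hv₁'def
  have hZZ : ∀ j, (lam' j) • stPull ((lam' j) ^ 2) (lam' j) (0 : ℝ) (0 : (EuclideanSpace ℝ (Fin 3))) v' =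
      σ • stPull (σ ^ 2) σ (0 : ℝ) (0 : (EuclideanSpace ℝ (Fin 3)))
        ((lam j) • stPull ((lam j) ^ 2) (lam j) (0 : ℝ) (0 : (EuclideanSpace ℝ (Fin 3))) v') := by
    intro j
    simp only [hlam'def]
    rw [zoom_zoom]
  -- (pt') identification with the zooms of `u` at the scales `R σλⱼ/2`
  have hpt' : ∀ (j : ℕ) (s' : ℝ) (y' : (EuclideanSpace ℝ (Fin 3))),
      ((lam' j) • stPull ((lam' j) ^ 2) (lam' j) (0 : ℝ) (0 : (EuclideanSpace ℝ (Fin 3))) v') s' y' =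
        ((R * (lam' j / 2)) / ν) • u (T + (R * (lam' j / 2)) ^ 2 * s' / ν) (x₀ + (R * (lam' j / 2)) • y') := by
    intro j s' y'
    have h := hpt j (σ ^ 2 * s') (σ • y')
    simp only [smul_stPull_apply, zero_add] at h ⊢
    simp only [hlam'def]
    rw [show (σ * lam j) ^ 2 * s' = lam j ^ 2 * (σ ^ 2 * s') by ring,
      show (σ * lam j) • y' = lam j • σ • y' by rw [smul_smul, mul_comm],
      mul_smul, h, smul_smul, smul_smul,
      show σ * (R * (lam j / 2) / ν) = R * (σ * lam j / 2) / ν by ring,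
      show T + (R * (lam j / 2)) ^ 2 * (σ ^ 2 * s') / ν = T + (R * (σ * lam j / 2)) ^ 2 * s' / ν by ring,
      show R * (lam j / 2) * σ = R * (σ * lam j / 2) by ring]
  -- (L3') local `L³` convergence of the rescaled zooms to `w'`
  have hus : ∀ f g : ℝ → (EuclideanSpace ℝ (Fin 3)) → (EuclideanSpace ℝ (Fin 3)),
      uncurry (f - g) = uncurry f - uncurry g := fun f g => rfl
  have hL3' : ∀ a : ℝ, 0 < a → Tendsto (fun j => eLpNorm
      (uncurry ((lam' j) • stPull ((lam' j) ^ 2) (lam' j) (0 : ℝ) (0 : (EuclideanSpace ℝ (Fin 3))) v') - uncurry w') 3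
      (volume.restrict (parabolicCylinder a (0 : ℝ × (EuclideanSpace ℝ (Fin 3)))))) atTop (𝓝 0) := by
    intro a ha
    have hdiff : ∀ j, uncurry ((lam' j) • stPull ((lam' j) ^ 2) (lam' j) (0 : ℝ) (0 : (EuclideanSpace ℝ (Fin 3))) v') -
        uncurry w' = uncurry (σ • stPull (σ ^ 2) σ (0 : ℝ) (0 : (EuclideanSpace ℝ (Fin 3)))
          ((lam j) • stPull ((lam j) ^ 2) (lam j) (0 : ℝ) (0 : (EuclideanSpace ℝ (Fin 3))) v' - w)) := by
      intro j
      rw [hZZ j]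
      funext z
      obtain ⟨s', y'⟩ := z
      simp only [hw'def, uncurry_apply_pair, Pi.sub_apply, smul_stPull_apply, smul_sub]
    have hconst : (‖σ‖ₑ * (ENNReal.ofReal ((σ ^ 2 * σ ^ 3)⁻¹)) ^ (1 / (3 : ℝ≥0∞).toReal)) ≠ ⊤ :=
      ENNReal.mul_ne_top enorm_ne_top
        (ENNReal.rpow_ne_top_of_nonneg (one_div_nonneg.2 ENNReal.toReal_nonneg) ENNReal.ofReal_ne_top)
    have key := ENNReal.Tendsto.const_mul (hL3 (a * σ) (mul_pos ha hσ)) (Or.inr hconst)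
    rw [mul_zero] at key
    refine key.congr fun j => ?_
    rw [hdiff j]
    conv_rhs => rw [show a = a * σ / σ by field_simp]
    rw [eLpNorm_uncurry_zoom hσ σ _ (a * σ) three_ne_zero ENNReal.ofNat_ne_top, hus]
  -- (ae') the rescaled limit agrees a.e. with the rescaled profile
  have hslab : stAffine (σ ^ 2) σ (0 : ℝ) (0 : (EuclideanSpace ℝ (Fin 3))) ⁻¹'
      (Iio (0 : ℝ) ×ˢ (univ : Set (EuclideanSpace ℝ (Fin 3)))) =
      Iio (0 : ℝ) ×ˢ (univ : Set (EuclideanSpace ℝ (Fin 3))) := by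
    ext z
    simp only [mem_preimage, mem_prod, mem_Iio, mem_univ, and_true, stAffine_fst, zero_add]
    exact ⟨fun h => neg_of_mul_neg_right h (pow_pos hσ 2).le,
      fun h => mul_neg_of_pos_of_neg (pow_pos hσ 2) h⟩
  have hae' : ∀ᵐ x ∂(volume.restrict (Iio (0 : ℝ) ×ˢ (univ : Set (EuclideanSpace ℝ (Fin 3))))),
      uncurry w' x = uncurry v₁' x := by
    have h := ae_eq_restrict_comp_stAffine (f := uncurry w) (g := uncurry v₁) (pow_pos hσ 2) hσ
      (0 : ℝ) (0 : (EuclideanSpace ℝ (Fin 3))) hae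
    rw [hslab] at h
    filter_upwards [h] with z hz
    show σ • uncurry w (stAffine (σ ^ 2) σ (0 : ℝ) (0 : (EuclideanSpace ℝ (Fin 3))) z) =
      σ • uncurry v₁ (stAffine (σ ^ 2) σ (0 : ℝ) (0 : (EuclideanSpace ℝ (Fin 3))) z)
    rw [show uncurry w (stAffine (σ ^ 2) σ (0 : ℝ) (0 : (EuclideanSpace ℝ (Fin 3))) z) =
      uncurry v₁ (stAffine (σ ^ 2) σ (0 : ℝ) (0 : (EuclideanSpace ℝ (Fin 3))) z) from hz]
  -- (P') the rescaled profile is in the class (scaling invariance of rate / continuity / mildness)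
  have hrate' : HasTypeITimeDecay C₁ v₁' := rate_smul_stPull hP.1 hσ
  have hcont' : ContinuousOn (uncurry v₁') (Iio (0 : ℝ) ×ˢ univ) := cont_smul_stPull hP.2.1 hσ
  have hmild' := mild_smul_stPull hP.2.2.1 hσ
  -- ## common bookkeeping: the time and the scale at slice `s`
  have e2 : ∀ j, T + (R * (σ * lam j / 2)) ^ 2 * (-1) / ν = T + (R * (lam j / 2)) ^ 2 * s / ν := by
    intro j
    have hs' : s = -σ ^ 2 := by rw [hσ2]; ring
    rw [hs']; ring
  have e3 : ∀ j, R * (σ * lam j / 2) * σ⁻¹ = R * (lam j / 2) := by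
    intro j
    calc R * (σ * lam j / 2) * σ⁻¹ = R * (lam j / 2) * (σ * σ⁻¹) := by ring
      _ = R * (lam j / 2) := by rw [mul_inv_cancel₀ hσne, mul_one]
  refine ⟨?_, ?_⟩
  · -- ## (i) VELOCITIES: the velocity upgrade at time `−1` of the rescaled frame
    have key := localZoomFrame_tendsto hν hT hsol.smooth_velocity.continuousOn hρ hM hR hball1 hlam'
      hlam0' hr₁ hr₁1 hKs hpt' hL3' hae' hcont' (σ⁻¹ • y)
    have hZ : ∀ j, ((lam' j) • stPull ((lam' j) ^ 2) (lam' j) (0 : ℝ) (0 : (EuclideanSpace ℝ (Fin 3))) v') (-1)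
        (σ⁻¹ • y) = σ • (((R * (lam j / 2)) / ν) • u (T + (R * (lam j / 2)) ^ 2 * s / ν)
          (x₀ + (R * (lam j / 2)) • y)) := by
      intro j
      rw [hpt' j (-1) (σ⁻¹ • y)]
      simp only [hlam'def, smul_smul]
      have e4 : R * (σ * lam j / 2) / ν = σ * (R * (lam j / 2) / ν) := by ring
      rw [e2 j, e3 j, e4]
    have hlimit : v₁' (-1) (σ⁻¹ • y) = σ • v₁ s y := by
      simp only [hv₁'def, smul_stPull_apply, smul_smul, mul_inv_cancel₀ hσne, one_smul, zero_add]
      rw [show σ ^ 2 * (-1) = s by rw [hσ2]; ring]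
    have key' : Tendsto (fun j => σ • (((R * (lam j / 2)) / ν) •
        u (T + (R * (lam j / 2)) ^ 2 * s / ν) (x₀ + (R * (lam j / 2)) • y))) atTop (𝓝 (σ • v₁ s y)) := by
      rw [← hlimit]
      exact Tendsto.congr hZ key
    have key3 := key'.const_smul σ⁻¹
    simp only [smul_smul, inv_mul_cancel_left₀ hσne, inv_mul_cancel₀ hσne, one_smul] at key3
    exact key3
  · -- ## (ii) VORTICITIES: the vorticity upgrade at time `−1` of the rescaled frame
    have key := localZoomFrame_curl_tendsto hν hT hsol.smooth_velocity.continuousOn hρ hM hR hball1 hlam'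
      hlam0' hr₁ hr₁1 hKs hpt' hL3' hae' hrate' hcont' hmild' (σ⁻¹ • y)
    have hcurlZ : ∀ j, curl (((lam' j) • stPull ((lam' j) ^ 2) (lam' j) (0 : ℝ) (0 : (EuclideanSpace ℝ (Fin 3))) v') (-1))
        (σ⁻¹ • y) = (-s) • (((R * (lam j / 2)) ^ 2 / ν) •
          curl (u (T + (R * (lam j / 2)) ^ 2 * s / ν)) (x₀ + (R * (lam j / 2)) • y)) := by
      intro j
      have hfun : ((lam' j) • stPull ((lam' j) ^ 2) (lam' j) (0 : ℝ) (0 : (EuclideanSpace ℝ (Fin 3))) v') (-1) =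
          (((R * (lam' j / 2)) / ν) • stPull ((R * (lam' j / 2)) ^ 2 / ν) (R * (lam' j / 2)) T x₀ u)
            (-1) := by
        funext y'
        rw [hpt' j (-1) y', smul_stPull_apply]
        congr 2
        ring
      have e1 : R * (σ * lam j / 2) / ν * (R * (σ * lam j / 2)) = (-s) * ((R * (lam j / 2)) ^ 2 / ν) := by
        rw [← hσ2]; ring
      rw [hfun, curl_smul_stPull]
      simp only [hlam'def, smul_smul]
      rw [e1, show T + (R * (σ * lam j / 2)) ^ 2 / ν * (-1) = T + (R * (lam j / 2)) ^ 2 * s / ν by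
        rw [← e2 j]; ring, e3 j]
    have hlimit : curl (v₁' (-1)) (σ⁻¹ • y) = (-s) • curl (v₁ s) y := by
      simp only [hv₁'def]
      rw [curl_smul_stPull]
      simp only [smul_smul, mul_inv_cancel₀ hσne, one_smul, zero_add]
      rw [show σ ^ 2 * (-1) = s by rw [hσ2]; ring, show σ * σ = -s by rw [← hσ2]; ring]
    have key' : Tendsto (fun j => (-s) • (((R * (lam j / 2)) ^ 2 / ν) •
        curl (u (T + (R * (lam j / 2)) ^ 2 * s / ν)) (x₀ + (R * (lam j / 2)) • y))) atTop
        (𝓝 ((-s) • curl (v₁ s) y)) := by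
      rw [← hlimit]
      exact Tendsto.congr hcurlZ key
    have key3 := key'.const_smul (-s)⁻¹
    simp only [smul_smul, inv_mul_cancel₀ hns.ne', inv_mul_cancel_left₀ hns.ne', one_smul]
      at key3
    exact key3

end Summit.NavierStokesRegularity.NavierStokesRegularity.Theorems.LocalHelicityTubeDoorLocalPointZoomVelCurlSlices

end
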